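import Summits.AtomisticToContinuum.FouriersLaw.Theses.HonestZwanzig

/-!
# OrthogonalOhm, line Sketch — typed RESIDUALS of the lead's stub R2 (for the planner; not stubs, not proposed)

The honest open content of `stub_bulkRegressionOhm` (and of the fixed-`N` existence clauses of R3/R4), stated over
the route's gadgets so a planner can file them (see work/R2-analysis.md):

* `FixedNLap` — `G(0) := [∫₀^∞ corr(e_x,e_y)]` is positive definite at every fixed `N ≥ 2` (asymptotic-variance
  positivity of every non-constant energy profile); with `corr ∈ L¹` (FeshbachIdentities (i)) it gives the existence of
  every `s ↓ 0` limit in the crux, in R2, R3 and R4 by continuity of `Matrix.inv` at an invertible matrix.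
* `UniformRegressionLocality` — the zero-frequency regression vector `θ_b = lap_0(j_b,e)·G(0)⁻¹` of the bond current on
  the energy profile is summably localised around `b`, uniformly in `N` (the N-uniform amplitude statement).
* `BulkRegressionLimit` — its first moment against `cov(e,e)` converges in the bulk to one constant `k`.
`UniformRegressionLocality ∧ BulkRegressionLimit ∧ FixedNLap ⇒ R2` is bookkeeping; the first two are open-problem class.
* `MemoryKernelLocality` (K1), `MemoryKernelBulkLimit` (K2) — the memory-kernel packaging of the same open content (route two-layer plan):
  with the contact locality (C) = R3′ and FixedNLap (F) they give every clause of the crux through the landed identities.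
-/

namespace Summit.AtomisticToContinuum.FouriersLaw.Theorems.HonestZwanzig.OrthogonalOhmLine

open MeasureTheory Filter Topology

/-- **FixedNLap (G(0) ≻ 0)**: for the pinned anharmonic chain at equilibrium and every `N ≥ 2`, the matrix of
time-integrated energy–energy correlations `∫₀^∞ corr(e_x,e_y)(t) dt` is positive definite. -/
def FixedNLap : Prop :=
  ∀ ω₂ lam β γ : ℝ, 0 < ω₂ → 0 < lam → 0 < β → 0 < γ → ∀ T : ℝ, 0 < T → ∀ N : ℕ, 2 ≤ N → let P := Literature.MathematicalPhysics.KineticTheory.HeatConduction.pinnedChain ω₂ lam β γ; let X := Literature.MathematicalPhysics.KineticTheory.HeatConduction.PhaseSpace N; let μ : MeasureTheory.Measure X := P.gibbsMeasure N T; let corr : (X → ℝ) → (X → ℝ) → ℝ → ℝ := fun f g t => (∫ z, f z * (∫ y, g y ∂(P.transitionKernel N T T t.toNNReal z)) ∂μ) - (∫ z, f z ∂μ) * (∫ z, g z ∂μ); let e : Fin N → X → ℝ := fun x z => z.2 x ^ 2 / 2 + P.U (z.1 x) + ∑ j : Fin N, ((if j.val = x.val + 1 then P.V (z.1 j - z.1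 x) / 2 else 0) + (if x.val = j.val + 1 then P.V (z.1 x - z.1 j) / 2 else 0)); ∀ ξ : Fin N → ℝ, ξ ≠ 0 → 0 < ∑ x : Fin N, ∑ y : Fin N, ξ x * (∫ t in Set.Ioi (0 : ℝ), corr (e x) (e y) t) * ξ y

/-- **UniformRegressionLocality**: N-uniform summable localisation of the zero-frequency (limit `s ↓ 0`) regression
vector of the bond current on the energy profile, `θ_b(s)_y = Σ_x lap_s(j_b,e_x) (G(s)⁻¹)_{xy}`, in the first-moment
weighted form that R2 consumes: `Σ_y |y − b| · |(θ_b χ)_y| ≤ C` with `χ = cov(e,e)`, for all small `s`, all `N`, all bonds. -/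
def UniformRegressionLocality : Prop :=
  ∀ ω₂ lam β γ : ℝ, 0 < ω₂ → 0 < lam → 0 < β → 0 < γ → ∀ T : ℝ, 0 < T → ∃ C s₀ : ℝ, 0 < s₀ ∧ ∀ N : ℕ, 2 ≤ N → let P := Literature.MathematicalPhysics.KineticTheory.HeatConduction.pinnedChain ω₂ lam β γ; let X := Literature.MathematicalPhysics.KineticTheory.HeatConduction.PhaseSpace N; let μ : MeasureTheory.Measure X := P.gibbsMeasure N T; let corr : (X → ℝ) → (X → ℝ) → ℝ → ℝ := fun f g t => (∫ z, f z * (∫ y, g y ∂(P.transitionKernel N T T t.toNNReal z)) ∂μ) - (∫ z, f z ∂μ) * (∫ z, g z ∂μ); let lap : ℝ → (X → ℝ) → (X → ℝ) → ℝ := fun s f g => ∫ t in Set.Ioi (0 : ℝ), Real.exp (-(s * t)) * corr f g t; let cov : (X → ℝ) → (X → ℝ) → ℝ := fun f g => (∫ z, f z * g z ∂μ) - (∫ z, f z ∂μ) * (∫ z, g z ∂μ); let e : Fin N → X → ℝ := fun x z => z.2 x ^ 2 / 2 + P.U (z.1 x) + ∑ j : Fin N, ((if j.val = x.val + 1 then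 P.V (z.1 j - z.1 x) / 2 else 0) + (if x.val = j.val + 1 then P.V (z.1 x - z.1 j) / 2 else 0)); let G : ℝ → Matrix (Fin N) (Fin N) ℝ := fun s => Matrix.of fun x y => lap s (e x) (e y); ∀ s : ℝ, 0 < s → s < s₀ → ∀ b : Fin N, b.val + 1 < N → (∑ z : Fin N, |((z.val : ℝ) - b.val)| * |∑ x : Fin N, ∑ y : Fin N, lap s (P.bondCurrent N b) (e x) * (G s)⁻¹ x y * cov (e y) (e z)|) ≤ C

/-- **(K1) MemoryKernelLocality**: the clamped memory kernel `𝔎_N(0)_{bc} = lim_{s↓0} schur_s(j_b, j_c)` exists at every `N`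
and has N-uniformly first-moment-summable rows with N-uniform tails (`Σ_c (1+|c−b|)|𝔎_{bc}| ≤ C`, `Σ_{|c−b| ≥ R} |𝔎_{bc}| ≤ ε`). -/
def MemoryKernelLocality : Prop :=
  ∀ ω₂ lam β γ : ℝ, 0 < ω₂ → 0 < lam → 0 < β → 0 < γ → ∀ T : ℝ, 0 < T → ∃ C : ℝ, ∀ ε : ℝ, 0 < ε → ∃ R : ℕ, ∀ N : ℕ, 2 ≤ N → let P := Literature.MathematicalPhysics.KineticTheory.HeatConduction.pinnedChain ω₂ lam β γ; let X := Literature.MathematicalPhysics.KineticTheory.HeatConduction.PhaseSpace N; let μ : MeasureTheory.Measure X := P.gibbsMeasure N T; let corr : (X → ℝ) → (X → ℝ) → ℝ → ℝ := fun f g t => (∫ z, f z * (∫ y, g y ∂(P.transitionKernel N T T t.toNNReal z)) ∂μ) - (∫ z, f z ∂μ) * (∫ z, g z ∂μ); let lap : ℝ → (X → ℝ) → (X → ℝ) → ℝ := fun s f g => ∫ t in Set.Ioi (0 : ℝ), Real.exp (-(s * t)) * corr f g t; let e : Fin N → X → ℝ := fun x z => z.2 x ^ 2 / 2 + P.U (z.1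 x) + ∑ j : Fin N, ((if j.val = x.val + 1 then P.V (z.1 j - z.1 x) / 2 else 0) + (if x.val = j.val + 1 then P.V (z.1 x - z.1 j) / 2 else 0)); let G : ℝ → Matrix (Fin N) (Fin N) ℝ := fun s => Matrix.of fun x y => lap s (e x) (e y); let schur : ℝ → (X → ℝ) → (X → ℝ) → ℝ := fun s f g => lap s f g - ∑ x : Fin N, ∑ y : Fin N, lap s f (e x) * (G s)⁻¹ x y * lap s (e y) g; ∃ K : Fin N → Fin N → ℝ, (∀ b c : Fin N, Filter.Tendsto (fun s => schur s (P.bondCurrent N b) (P.bondCurrent N c)) (nhdsWithin (0 : ℝ) (Set.Ioi 0)) (nhds (K b c))) ∧ (∀ b : Fin N, (∑ c : Fin N, (1 + |((c.val : ℝ) - b.val)|) * |K b c|) ≤ C) ∧ (∀ b : Fin N, (∑ c : Fin N, if R ≤ Int.natAbs ((c.val : ℤ) - b.val) then |K b c| else 0) ≤ ε)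

/-- **(K2) MemoryKernelBulkLimit**: the row sums `ρ_b = Σ_c 𝔎_N(0)_{bc}` (= `lim schur_s(j_b, J)` by second-slot linearity) equal
one constant `k` up to `ε` on bonds at distance `≥ R(ε)` from both ends, uniformly in `N`. -/
def MemoryKernelBulkLimit : Prop :=
  ∀ ω₂ lam β γ : ℝ, 0 < ω₂ → 0 < lam → 0 < β → 0 < γ → ∀ T : ℝ, 0 < T → ∃ k : ℝ, ∀ ε : ℝ, 0 < ε → ∃ R : ℕ, ∀ N : ℕ, 2 ≤ N → let P := Literature.MathematicalPhysics.KineticTheory.HeatConduction.pinnedChain ω₂ lam β γ; let X := Literature.MathematicalPhysics.KineticTheory.HeatConduction.PhaseSpace N; let μ : MeasureTheory.Measure X := P.gibbsMeasure N T; let corr : (X → ℝ) → (X → ℝ) → ℝ → ℝ := fun f g t => (∫ z, f z * (∫ y, g y ∂(P.transitionKernel N T T t.toNNReal z)) ∂μ) - (∫ z, f z ∂μ) * (∫ z, g z ∂μ); let lap : ℝ → (X → ℝ) → (X → ℝ) → ℝ := fun s f g => ∫ t in Set.Ioi (0 : ℝ), Real.exp (-(s * t)) * corr f g t; let e : Fin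 N → X → ℝ := fun x z => z.2 x ^ 2 / 2 + P.U (z.1 x) + ∑ j : Fin N, ((if j.val = x.val + 1 then P.V (z.1 j - z.1 x) / 2 else 0) + (if x.val = j.val + 1 then P.V (z.1 x - z.1 j) / 2 else 0)); let G : ℝ → Matrix (Fin N) (Fin N) ℝ := fun s => Matrix.of fun x y => lap s (e x) (e y); let schur : ℝ → (X → ℝ) → (X → ℝ) → ℝ := fun s f g => lap s f g - ∑ x : Fin N, ∑ y : Fin N, lap s f (e x) * (G s)⁻¹ x y * lap s (e y) g; ∀ b : Fin N, R ≤ b.val → b.val + 2 + R ≤ N → ∀ ρ : ℝ, Filter.Tendsto (fun s => ∑ c : Fin N, schur s (P.bondCurrent N b) (P.bondCurrent N c)) (nhdsWithin (0 : ℝ) (Set.Ioi 0)) (nhds ρ) → |ρ - k| ≤ ε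

end Summit.AtomisticToContinuum.FouriersLaw.Theorems.HonestZwanzig.OrthogonalOhmLine
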